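import Summits.CriticalPhenomena.PercolationContinuityZ3.Theorems.PercNecklaceBackboneTruncatedSusceptibilityFiniteOfThetaOfBlockingSum
import Summits.CriticalPhenomena.PercolationContinuityZ3.Theorems.PercNecklaceBackboneTruncatedSusceptibilityFiniteOfThetaOfVolumeTail
import HarnessLib

/-!
# Crux `TruncatedSusceptibilityFiniteOfTheta` (stmt-CriticalPhenomena-0852): the blocking certificate for the whole
# "thin critical dust" family

Lead prover-line-stmt-CriticalPhenomena-0852-c3-0 (line `registered`, continuation c3), 2026-08-17. `u_n = blockProb 3 (criticalProbI 3) n`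
(critical annulus blocking probability of crux `PercNonProliferation.SubpolynomialBlocking`, stmt-CriticalPhenomena-4446).

Crux 0852 is the weakest of the jump-world statements "finite clusters at a percolating `p_c(ℤ³)` are small" (landed edges:
0853 `FiniteRadiusExpDecayOfTheta` ⇒ 0852, p150587; 0943 `FiniteClusterVolumeTail` ⇒ 0852 and 6065 `FiniteClusterMomentsOfTheta` ⇒ 0852,
p158238; 7204's `stub_thinDust` ⇒ 0852, p156696), and it is the summit modulo non-summable critical blocking
(`TruncatedSusceptibilityFiniteOfTheta_iff_summit_of_not_summable_blocking`, p158780). Hence EVERY member of the family concludes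
`θ(p_c) = 0` once `Σ_n u_n(p_c) = ∞` — in particular under crux 4446 (`not_summable_blockProb_of_subpolynomialBlocking`: `u_n ≥ 1/n`
eventually is not summable):

* `summit_of_not_summable_blocking_of_crux` / `…_of_FiniteRadiusExpDecayOfTheta` / `…_of_FiniteClusterVolumeTail` /
  `…_of_FiniteClusterMomentsOfTheta` / `…_of_thinDust`;
* `summit_of_subpolynomialBlocking_of_FiniteRadiusExpDecayOfTheta` / `…_of_FiniteClusterMomentsOfTheta` / `…_of_thinDust`
  (the 0943 case is `FreeBoxSparse.Quarantine.percolationContinuityZ3_of_subpolynomialBlocking_of_finiteClusterVolumeTail`, already in tree).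
No new definitions; no sorry.
-/

noncomputable section

namespace Summit.CriticalPhenomena.PercolationContinuityZ3.Theorems.TruncatedSusceptibilityFiniteOfTheta

open MeasureTheory Filter Topology
open Literature.Probability.Percolation Literature.Probability.LatticeModels
open Summit.CriticalPhenomena.PercolationContinuityZ3.Theorems.SubpolynomialBlocking.Negative (blockProb blockProb_nonneg)

/-- **`SubpolynomialBlocking ⇒ Σ_n u_n(p_c) = ∞`**: with `s = 1`, `u_n ≥ n^{-1}` eventually, and the harmonic series diverges. [folklore] -/
theorem not_summable_blockProb_of_subpolynomialBlocking
    (h4 : Summit.CriticalPhenomena.PercolationContinuityZ3.Theses.PercNonProliferation.SubpolynomialBlocking) :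
    ¬ Summable fun n : ℕ => blockProb 3 (criticalProbI 3) n := by
  intro hs
  have hev : ∀ᶠ n : ℕ in atTop, (n : ℝ) ^ (-(1 : ℝ)) ≤ blockProb 3 (criticalProbI 3) n := h4 1 one_pos
  obtain ⟨N, hN⟩ := hev.exists_forall_of_atTop
  -- the shifted series `u_{n+N+1}` dominates `1/(n+N+1)`
  have hshift : Summable fun n : ℕ => blockProb 3 (criticalProbI 3) (n + (N + 1)) :=
    (summable_nat_add_iff (N + 1)).2 hs
  have hharm : Summable fun n : ℕ => (1 : ℝ) / ((n + (N + 1) : ℕ) : ℝ) := by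
    refine hshift.of_nonneg_of_le (fun n => by positivity) fun n => ?_
    have hpos : (0 : ℝ) < ((n + (N + 1) : ℕ) : ℝ) := by positivity
    have h := hN (n + (N + 1)) (by omega)
    rwa [Real.rpow_neg hpos.le, Real.rpow_one, inv_eq_one_div] at h
  exact Real.not_summable_one_div_natCast
    ((summable_nat_add_iff (f := fun n : ℕ => (1 : ℝ) / (n : ℝ)) (N + 1)).1 hharm)

/-- **`Σ u_n(p_c) = ∞` and crux 0852 give `θ(p_c) = 0`** (one direction of the certificate, for chaining). [folklore] -/
theorem summit_of_not_summable_blocking_of_crux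
    (hU : ¬ Summable fun n : ℕ => blockProb 3 (criticalProbI 3) n)
    (hL : Summit.CriticalPhenomena.PercolationContinuityZ3.Theses.PercNecklaceBackbone.TruncatedSusceptibilityFiniteOfTheta) :
    _root_.PercolationContinuityZ3 :=
  (TruncatedSusceptibilityFiniteOfTheta_iff_summit_of_not_summable_blocking hU).1 hL

/-- **Crux 0853 `FiniteRadiusExpDecayOfTheta` concludes `θ(p_c) = 0` modulo `Σ u_n(p_c) = ∞`.** [folklore] -/
theorem summit_of_not_summable_blocking_of_FiniteRadiusExpDecayOfTheta
    (hU : ¬ Summable fun n : ℕ => blockProb 3 (criticalProbI 3) n)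
    (h : Summit.CriticalPhenomena.PercolationContinuityZ3.Theses.PercTruncatedSusceptibility.FiniteRadiusExpDecayOfTheta) :
    _root_.PercolationContinuityZ3 :=
  summit_of_not_summable_blocking_of_crux hU (TruncatedSusceptibilityFiniteOfTheta_of_FiniteRadiusExpDecayOfTheta h)

/-- **Crux 0943 `FiniteClusterVolumeTail` concludes `θ(p_c) = 0` modulo `Σ u_n(p_c) = ∞`.** [folklore] -/
theorem summit_of_not_summable_blocking_of_FiniteClusterVolumeTail
    (hU : ¬ Summable fun n : ℕ => blockProb 3 (criticalProbI 3) n)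
    (h : Summit.CriticalPhenomena.PercolationContinuityZ3.Theses.PercDebrisSweep.FiniteClusterVolumeTail) :
    _root_.PercolationContinuityZ3 :=
  summit_of_not_summable_blocking_of_crux hU (TruncatedSusceptibilityFiniteOfTheta_of_FiniteClusterVolumeTail h)

/-- **Crux 6065 `FiniteClusterMomentsOfTheta` concludes `θ(p_c) = 0` modulo `Σ u_n(p_c) = ∞`.** [folklore] -/
theorem summit_of_not_summable_blocking_of_FiniteClusterMomentsOfTheta
    (hU : ¬ Summable fun n : ℕ => blockProb 3 (criticalProbI 3) n)
    (h : Summit.CriticalPhenomena.PercolationContinuityZ3.Theses.PercVarianceSandwich.FiniteClusterMomentsOfTheta) :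
    _root_.PercolationContinuityZ3 :=
  summit_of_not_summable_blocking_of_crux hU (TruncatedSusceptibilityFiniteOfTheta_of_FiniteClusterMomentsOfTheta h)

/-- **Thin dust (crux 7204's open stub `stub_thinDust`, verbatim) concludes `θ(p_c) = 0` modulo `Σ u_n(p_c) = ∞`.** [folklore] -/
theorem summit_of_not_summable_blocking_of_thinDust
    (hU : ¬ Summable fun n : ℕ => blockProb 3 (criticalProbI 3) n)
    (hdust : 0 < theta (zdGraph 3) (0 : Fin 3 → ℤ) (criticalProbI 3) →
      ∀ k : ℕ, ∃ C : ℝ, ∀ n : ℕ,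
        (bondPercolation (zdGraph 3) (criticalProbI 3)).real (siteToBoundary 3 n \ percolatesAt 0) ≤
          C / ((n : ℝ) + 1) ^ k) :
    _root_.PercolationContinuityZ3 :=
  summit_of_not_summable_blocking_of_crux hU (TruncatedSusceptibilityFiniteOfTheta_of_thinDust hdust)

/-- **`SubpolynomialBlocking ∧ FiniteRadiusExpDecayOfTheta ⇒ θ(p_c) = 0`** (cruxes 4446 ∧ 0853). [folklore] -/
theorem summit_of_subpolynomialBlocking_of_FiniteRadiusExpDecayOfTheta
    (h4 : Summit.CriticalPhenomena.PercolationContinuityZ3.Theses.PercNonProliferation.SubpolynomialBlocking)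
    (h : Summit.CriticalPhenomena.PercolationContinuityZ3.Theses.PercTruncatedSusceptibility.FiniteRadiusExpDecayOfTheta) :
    _root_.PercolationContinuityZ3 :=
  summit_of_not_summable_blocking_of_FiniteRadiusExpDecayOfTheta (not_summable_blockProb_of_subpolynomialBlocking h4) h

/-- **`SubpolynomialBlocking ∧ FiniteClusterMomentsOfTheta ⇒ θ(p_c) = 0`** (cruxes 4446 ∧ 6065). [folklore] -/
theorem summit_of_subpolynomialBlocking_of_FiniteClusterMomentsOfTheta
    (h4 : Summit.CriticalPhenomena.PercolationContinuityZ3.Theses.PercNonProliferation.SubpolynomialBlocking)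
    (h : Summit.CriticalPhenomena.PercolationContinuityZ3.Theses.PercVarianceSandwich.FiniteClusterMomentsOfTheta) :
    _root_.PercolationContinuityZ3 :=
  summit_of_not_summable_blocking_of_FiniteClusterMomentsOfTheta (not_summable_blockProb_of_subpolynomialBlocking h4) h

/-- **`SubpolynomialBlocking ∧ thin dust ⇒ θ(p_c) = 0`** (crux 4446 ∧ 7204's `stub_thinDust`). [folklore] -/
theorem summit_of_subpolynomialBlocking_of_thinDust
    (h4 : Summit.CriticalPhenomena.PercolationContinuityZ3.Theses.PercNonProliferation.SubpolynomialBlocking)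
    (hdust : 0 < theta (zdGraph 3) (0 : Fin 3 → ℤ) (criticalProbI 3) →
      ∀ k : ℕ, ∃ C : ℝ, ∀ n : ℕ,
        (bondPercolation (zdGraph 3) (criticalProbI 3)).real (siteToBoundary 3 n \ percolatesAt 0) ≤
          C / ((n : ℝ) + 1) ^ k) :
    _root_.PercolationContinuityZ3 :=
  summit_of_not_summable_blocking_of_thinDust (not_summable_blockProb_of_subpolynomialBlocking h4) hdust

/-- **Registered sub-goal `stub_criticalRadiusMoment_iff_summit_of_subpolynomialBlocking`: `SubpolynomialBlocking ⇒
(stub_criticalRadiusMoment ↔ θ(p_c) = 0)`** — under crux 4446 the registered open stub of this crux is a certified restatement of the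
conjunct. [folklore] -/
theorem stub_criticalRadiusMoment_iff_summit_of_subpolynomialBlocking : Summit.CriticalPhenomena.PercolationContinuityZ3.Theses.PercNonProliferation.SubpolynomialBlocking → ((0 < Literature.Probability.Percolation.theta (Literature.Probability.LatticeModels.zdGraph 3) (0 : Literature.Probability.LatticeModels.Site 3) (Literature.Probability.Percolation.criticalProbI 3) → Summable fun n : ℕ => ((n : ℝ) + 1) ^ 2 * (Literature.Probability.Percolation.bondPercolation (Literature.Probability.LatticeModels.zdGraph 3) (Literature.Probability.Percolation.criticalProbI 3)).real (Literature.Probability.Percolation.siteToBoundary 3 n \ Literature.Probability.Percolation.percolatesAt 0)) ↔ Literature.Probability.Percolation.PercolationContinuityZ3) := by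
  intro h4
  exact criticalRadiusMoment_iff_summit_of_not_summable_blocking (not_summable_blockProb_of_subpolynomialBlocking h4)

end Summit.CriticalPhenomena.PercolationContinuityZ3.Theorems.TruncatedSusceptibilityFiniteOfTheta

end
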